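import Literature.AnabelianGeometry.AbsoluteAnabelian.DiagramsOfCategories

/-!
# Families of homotopies pulled back along a morphism of oriented graphs ([AbsTopIII] Def. 3.5 (i), (ii))

S. Mochizuki, *Topics in Absolute Anabelian Geometry III*, Def. 3.5 (i)–(ii) pp. 74–75 of the kurims
manuscript (`paper:url-5493eb38cbb7`; bib key `MochizukiAbsTopIII2015`).  Generic bookkeeping
(seat abc-iut-L4-t5, toolkit for the literal compatibility statements of Cor. 3.6 (iii)/(v) in
`FrobeniusPictureMLFCompatibility.lean`, and equally for [AbsTopIII] Cor. 3.7 / 4.5 / 5.5): print uses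
ONE notion of "family of homotopies on `𝒟`" and "compatible families" (Def. 3.5 (ii)) for families that
live on SUB-diagrams `𝒟_{≤n}`, `𝒟_{≤n} ∪ {core}`, … of a diagram `𝒟`, i.e. it tacitly identifies a family on
a sub-diagram with a family on `𝒟` supported on paths inside the sub-diagram.  This file makes the
identification a construction:

* `DiagramOfCategories.comapAlong D F` — the diagram `F^*𝒟` on `Γ⃗'` induced along a morphism of oriented
  graphs `F : Γ⃗' → Γ⃗` (same categories and functors, re-indexed); `pathFunctor_comapAlong` — its path
  functors ARE those of `𝒟` along `F` (an equality);
* `HomotopyFamily.comap K F` — the pulled-back family `F^*K` on `F^*𝒟`: boundary pairs `([γ₁],[γ₂])` with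
  `(F[γ₁], F[γ₂]) ∈ E_K`, homotopies those of `K` (re-typed along `pathFunctor_comapAlong`); the axioms
  (Def. 3.5 (ii): identity on the diagonal, composition, whiskering) are inherited from `K`;
* `HomotopyFamily.comap_compatible` — `F^*K` is compatible with `K` along `F`: every boundary pair of
  `F^*K` maps to a boundary pair of `K` with (heterogeneously) the same homotopy (the form
  `HomotopyFamily.CompatibleAlong` of `AbsTopIII/FrobeniusPictureMLFCompatibility.lean`);
* `DiagramOfCategories.ext'` / `eq_comapAlong` and the `cast_*` lemmas — identifying a hand-made
  presentation of a sub-diagram with `F^*𝒟` and transporting families along the identification.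

Pure category-theoretic plumbing; no claim of the paper is asserted; nothing here bears on [IUTchIII]
Cor. 3.12.
-/

namespace Literature.AnabelianGeometry.AbsoluteAnabelian

open _root_.CategoryTheory _root_.Quiver

universe v u w w'

namespace DiagramOfCategories

variable {V : Type w} [Quiver.{v} V] {V' : Type w'} [Quiver.{v} V']
  (D : DiagramOfCategories.{v, u, w} V) (F : V' ⥤q V)

/-- **`F^*𝒟`**: the diagram of categories on `Γ⃗'` induced along a morphism of oriented graphs
`F : Γ⃗' → Γ⃗_𝒟` — the category at `v'` is `𝒟_{F v'}`, the functor on `e'` is `𝒟_{F e'}` (Def. 3.5 (i);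
for `F` the inclusion of a sub-graph this is the sub-diagram `𝒟|_{Γ⃗'}`).
[cite: MochizukiAbsTopIII2015, Definition 3.5 (i) p.74] -/
abbrev comapAlong : DiagramOfCategories.{v, u, w'} V' where
  obj a := D.obj (F.obj a)
  cat a := D.cat (F.obj a)
  map e := D.map (F.map e)

/-- Extensionality for diagrams of categories: same categories at the vertices (types and category
structures) and same functors on the edges (heterogeneously, over the vertex identifications).
[cite: MochizukiAbsTopIII2015, Definition 3.5 (i) p.74] -/
theorem ext' {D₁ D₂ : DiagramOfCategories.{v, u, w'} V'} (hobj : ∀ a, D₁.obj a = D₂.obj a)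
    (hcat : ∀ a, HEq (D₁.cat a) (D₂.cat a))
    (hmap : ∀ {a b : V'} (e : a ⟶ b), HEq (D₁.map e) (D₂.map e)) : D₁ = D₂ := by
  rcases D₁ with @⟨obj₁, cat₁, map₁⟩
  rcases D₂ with @⟨obj₂, cat₂, map₂⟩
  obtain rfl : obj₁ = obj₂ := funext hobj
  obtain rfl : cat₁ = cat₂ := funext fun a => eq_of_heq (hcat a)
  have hm : @map₁ = @map₂ := by
    funext a b e
    exact eq_of_heq (hmap e)
  cases hm
  rfl

/-- A presentation `𝒟'` of a sub-diagram that agrees with `F^*𝒟` vertex by vertex and edge by edge IS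
`F^*𝒟` (the form in which the presentations `𝒟_{≤2} ∪ {𝒩}`, `𝒟_{≤n} ∪ {core}` of [AbsTopIII] Cor. 3.6
are identified with sub-diagrams of `𝒟`). [cite: MochizukiAbsTopIII2015, Definition 3.5 (i) p.74] -/
theorem eq_comapAlong {D' : DiagramOfCategories.{v, u, w'} V'} (hobj : ∀ a, D'.obj a = D.obj (F.obj a))
    (hcat : ∀ a, HEq (D'.cat a) (D.cat (F.obj a)))
    (hmap : ∀ {a b : V'} (e : a ⟶ b), HEq (D'.map e) (D.map (F.map e))) : D' = D.comapAlong F :=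
  ext' hobj hcat hmap

/-- The path functors of `F^*𝒟` are the path functors of `𝒟` along `F`: `(F^*𝒟)_{[γ]} = 𝒟_{F[γ]}`.
[cite: MochizukiAbsTopIII2015, Definition 3.5 (i) p.75] -/
theorem pathFunctor_comapAlong : ∀ {a b : V'} (p : Path a b),
    (D.comapAlong F).pathFunctor p = D.pathFunctor (F.mapPath p) := by
  intro a b p
  induction p with
  | nil => rw [Prefunctor.mapPath_nil, pathFunctor_nil, pathFunctor_nil]
  | cons p e ih => rw [Prefunctor.mapPath_cons, pathFunctor_cons, pathFunctor_cons, ih]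

namespace HomotopyFamily

variable {D}
variable (K : D.HomotopyFamily)

/-- Re-indexing a homotopy of `K` along equal pairs of paths (bookkeeping: the homotopy at
`(p₂, q₂)` is that at `(p₁, q₁) = (p₂, q₂)` conjugated by the `eqToHom`s).
[cite: MochizukiAbsTopIII2015, Definition 3.5 (ii) p.75] -/
theorem η_congr {a b : V} {p₁ p₂ q₁ q₂ : Path a b} (hp : p₁ = p₂) (hq : q₁ = q₂) (h : K.E p₁ q₁) :
    K.η h = eqToHom (by rw [hp]) ≫ K.η (hp ▸ hq ▸ h : K.E p₂ q₂) ≫ eqToHom (by rw [hq]) := by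
  subst hp; subst hq; simp

/-- `eqToHom` bookkeeping: a morphism conjugated by `eqToHom`s twice over is conjugated once
(all `eqToHom`s between the same objects agree). [folklore] -/
private theorem eqToHom_conj_conj {C : Type*} [Category C] {a₁ a₂ a₃ b₁ b₂ b₃ : C} (M : a₃ ⟶ b₃)
    (h₁ : a₁ = a₃) (h₂ : b₃ = b₁) (h₃ : a₁ = a₂) (h₄ : a₂ = a₃) (h₅ : b₃ = b₂) (h₆ : b₂ = b₁) :
    eqToHom h₁ ≫ M ≫ eqToHom h₂ = eqToHom h₃ ≫ (eqToHom h₄ ≫ M ≫ eqToHom h₅) ≫ eqToHom h₆ := by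
  subst h₃; subst h₄; subst h₅; subst h₆; simp

/-- **The pulled-back family `F^*K` on `F^*𝒟`** (Def. 3.5 (ii) read on a sub-diagram): boundary set
`E_{F^*K} = {([γ₁],[γ₂]) | (F[γ₁], F[γ₂]) ∈ E_K}` (saturated, since `F` is compatible with composition
of paths), homotopies `ζ_{([γ₁],[γ₂])} := ζ^K_{(F[γ₁],F[γ₂])}` re-typed along `(F^*𝒟)_{[γ]} = 𝒟_{F[γ]}`.
[cite: MochizukiAbsTopIII2015, Definition 3.5 (ii) p.75] -/
def comap : (D.comapAlong F).HomotopyFamily where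
  E := fun ⦃_ _⦄ p q => K.E (F.mapPath p) (F.mapPath q)
  isSaturated :=
    { refl_left := fun ⦃_ _ _ _⦄ h => K.isSaturated.refl_left h
      refl_right := fun ⦃_ _ _ _⦄ h => K.isSaturated.refl_right h
      trans := fun ⦃_ _ _ _ _⦄ h₁ h₂ => K.isSaturated.trans h₁ h₂
      precomp := fun ⦃_ _ _ _ _⦄ h r => by
        simpa only [Prefunctor.mapPath_comp] using K.isSaturated.precomp h (F.mapPath r)
      postcomp := fun ⦃_ _ _ _ _⦄ h r => by
        simpa only [Prefunctor.mapPath_comp] using K.isSaturated.postcomp h (F.mapPath r) }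
  η := fun ⦃_ _ p q⦄ h =>
    eqToHom (D.pathFunctor_comapAlong F p) ≫ K.η h ≫ eqToHom (D.pathFunctor_comapAlong F q).symm
  η_refl := fun ⦃_ _ _⦄ h => by
    show eqToHom _ ≫ K.η h ≫ eqToHom _ = 𝟙 _
    rw [K.η_refl h, Category.id_comp, eqToHom_trans, eqToHom_refl]
  η_trans := fun ⦃_ _ _ _ _⦄ h₁ h₂ => by
    show eqToHom _ ≫ K.η (K.isSaturated.trans h₁ h₂) ≫ eqToHom _ =
      (eqToHom _ ≫ K.η h₁ ≫ eqToHom _) ≫ (eqToHom _ ≫ K.η h₂ ≫ eqToHom _)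
    rw [K.η_trans h₁ h₂]
    simp only [Category.assoc, eqToHom_trans_assoc, eqToHom_refl, Category.id_comp]
  η_whisker := fun ⦃a b c d p q⦄ h r₁ r₂ => by
    -- move `K.η` to the re-bracketed pair of paths, apply `K.η_whisker`, and compare componentwise
    have hp : F.mapPath (r₁.comp (p.comp r₂)) =
        (F.mapPath r₁).comp ((F.mapPath p).comp (F.mapPath r₂)) := by
      rw [Prefunctor.mapPath_comp, Prefunctor.mapPath_comp]
    have hq : F.mapPath (r₁.comp (q.comp r₂)) =
        (F.mapPath r₁).comp ((F.mapPath q).comp (F.mapPath r₂)) := by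
      rw [Prefunctor.mapPath_comp, Prefunctor.mapPath_comp]
    show eqToHom _ ≫ K.η _ ≫ eqToHom _ = _
    rw [K.η_congr hp hq, K.η_whisker h (F.mapPath r₁) (F.mapPath r₂)]
    ext x
    have hx : ((D.comapAlong F).pathFunctor r₁).obj x = (D.pathFunctor (F.mapPath r₁)).obj x :=
      Functor.congr_obj (D.pathFunctor_comapAlong F r₁) x
    simp only [NatTrans.comp_app, eqToHom_app, Functor.whiskerLeft_app, Functor.whiskerRight_app,
      Category.assoc, Functor.map_comp, eqToHom_map]
    rw [Functor.congr_hom (D.pathFunctor_comapAlong F r₂), NatTrans.congr (K.η h) hx]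
    simp only [Category.assoc, eqToHom_map, Functor.map_comp, eqToHom_trans, eqToHom_trans_assoc]
    exact eqToHom_conj_conj _ _ _ _ _ _ _

/-- The boundary set of `F^*K`. [cite: MochizukiAbsTopIII2015, Definition 3.5 (ii) p.75] -/
theorem comap_E_iff {a b : V'} (p q : Path a b) :
    (K.comap F).E p q ↔ K.E (F.mapPath p) (F.mapPath q) := Iff.rfl

/-- The homotopies of `F^*K`. [cite: MochizukiAbsTopIII2015, Definition 3.5 (ii) p.75] -/
theorem comap_η {a b : V'} {p q : Path a b} (h : (K.comap F).E p q) :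
    (K.comap F).η h = eqToHom (D.pathFunctor_comapAlong F p) ≫ K.η h ≫
      eqToHom (D.pathFunctor_comapAlong F q).symm := rfl

/-- An `eqToHom`-conjugate is heterogeneously equal to the original morphism.
[cite: MochizukiAbsTopIII2015, Definition 3.5 (ii) p.75] -/
theorem heq_eqToHom_comp_comp_eqToHom {C : Type*} [Category C] {a a' b b' : C} (ha : a = a') (hb : b' = b)
    (f : a' ⟶ b') : HEq (eqToHom ha ≫ f ≫ eqToHom hb) f := by
  subst ha; subst hb; simp

/-- **`F^*K` is compatible with `K` along `F`** (Def. 3.5 (ii) "compatible", across the embedding):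
every boundary pair of `F^*K` maps to a boundary pair of `K` carrying (heterogeneously) the same
homotopy. [cite: MochizukiAbsTopIII2015, Definition 3.5 (ii) p.75] -/
theorem comap_compatible {a b : V'} (p q : Path a b) (h : (K.comap F).E p q) :
    ∃ h' : K.E (F.mapPath p) (F.mapPath q), HEq ((K.comap F).η h) (K.η h') :=
  ⟨h, heq_eqToHom_comp_comp_eqToHom _ _ _⟩

/-- Transport of a family of homotopies along an equality of diagrams does not change its boundary set.
[cite: MochizukiAbsTopIII2015, Definition 3.5 (ii) p.75] -/
theorem cast_E_iff {D₁ D₂ : DiagramOfCategories.{v, u, w'} V'} (h : D₁ = D₂) (H : D₁.HomotopyFamily)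
    {a b : V'} (p q : Path a b) : (h ▸ H).E p q ↔ H.E p q := by
  subst h; exact Iff.rfl

/-- ... nor its homotopies (heterogeneously). [cite: MochizukiAbsTopIII2015, Definition 3.5 (ii) p.75] -/
theorem cast_η_heq {D₁ D₂ : DiagramOfCategories.{v, u, w'} V'} (h : D₁ = D₂) (H : D₁.HomotopyFamily)
    {a b : V'} {p q : Path a b} (hE : (h ▸ H).E p q) :
    HEq ((h ▸ H).η hE) (H.η ((cast_E_iff h H p q).mp hE)) := by
  subst h; exact HEq.rfl

/-- **The pulled-back family on a presentation** `𝒟' = F^*𝒟` of a sub-diagram — `F^*K` transported to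
`𝒟'` — is compatible with `K` along `F` (raw form). [cite: MochizukiAbsTopIII2015, Definition 3.5 (ii) p.75] -/
theorem cast_comap_compatible {D' : DiagramOfCategories.{v, u, w'} V'} (h : D.comapAlong F = D')
    {a b : V'} (p q : Path a b) (hE : (h ▸ K.comap F).E p q) :
    ∃ h' : K.E (F.mapPath p) (F.mapPath q), HEq ((h ▸ K.comap F).η hE) (K.η h') := by
  subst h; exact K.comap_compatible F p q hE

end HomotopyFamily

end DiagramOfCategories

end Literature.AnabelianGeometry.AbsoluteAnabelian
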